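import Summits.NavierStokesRegularity.NavierStokesRegularity.Theorems.RungReynoldsOne.Negative.WithoutLerayHopfFalse

/-!
# `ScaledEnergyBound` (stmt-NavierStokesRegularity-2884): the side condition `0 < T` is load-bearing

Negative (support) lemma for the support item `TypeICertificateLadder.ScaledEnergyBound` — which the
line `bp-scaled-energy` of the crux `TypeIConcentration` (stmt-NavierStokesRegularity-2881) re-derives
verbatim (`scaledEnergyBound_of_stub`; it was that line's registered stub until 2026-08-16T02:18Z) —
from the drefute seat of that line, built on the drift witness family of
`RungReynoldsOne/Negative/WithoutLerayHopfFalse.lean`. For the CRUX, `0 < ν` and `0 < T` are decoration (`T ≤ 0` makes `¬HasSmoothExtensionPast`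
unsatisfiable); for `ScaledEnergyBound` the clause `0 < T` is NOT: with it dropped the statement is
false (`scaledEnergyBound_false_without_posT`). Reason: for `T ≤ 0` the classical interval `[0, T)`
is empty and every clause of `IsLerayHopfOn T …` lives at times `≥ 0`, so the slices `u t`, `t < T`,
are unconstrained except by the pointwise rate; the drift `u(t,x) = (−1−t)^{-1/2} driftDir` for
`t < T = −1` (rest state from `−1` on) saturates the Type-I(1) rate and has scaled local energy
`|B₁| r₀² (−1−t)⁻¹ → ∞` at the fixed radius `r₀`. MORAL for provers of 2884 and for sub-stubs of the
line: slices at negative times are junk even when `0 < T`; every window `[T − r²/ν, T)` used in the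
local-energy Gronwall must be kept inside `[0, T)` (`r² ≤ νT`), which the existential `r₀` permits.
[folklore]
-/

noncomputable section

set_option linter.dupNamespace false

namespace Summit.NavierStokesRegularity.NavierStokesRegularity.Theorems.TypeIConcentration.Negative

open Set Filter Topology MeasureTheory Metric Function
open scoped ENNReal
open Literature.Analysis.FluidPDE
open Summit.NavierStokesRegularity.NavierStokesRegularity.Theorems.RungReynoldsOneNegative

/-! ## The pre-initial junk profile -/

/-- The junk amplitude `gJ(t) = (−1−t)^{-1/2}` for `t < −1`, `0` from `−1` on. -/
def gJ (t : ℝ) : ℝ := if t < -1 then (Real.sqrt (-1 - t))⁻¹ else 0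

/-- `gJ` vanishes from `−1` on. [folklore] -/
theorem gJ_of_ge {t : ℝ} (ht : -1 ≤ t) : gJ t = 0 := by simp [gJ, not_lt.2 ht]

/-- `gJ` before `−1`. [folklore] -/
theorem gJ_of_lt {t : ℝ} (ht : t < -1) : gJ t = (Real.sqrt (-1 - t))⁻¹ := by simp [gJ, ht]

/-- `gJ 0 = 0`. [folklore] -/
theorem gJ_zero : gJ 0 = 0 := gJ_of_ge (by norm_num)

/-- `gJ > 0` before `−1`. [folklore] -/
theorem gJ_pos {t : ℝ} (ht : t < -1) : 0 < gJ t := by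
  rw [gJ_of_lt ht]; exact inv_pos.2 (Real.sqrt_pos.2 (by linarith))

/-- `gJ(t)² = (−1−t)⁻¹` before `−1`. [folklore] -/
theorem gJ_sq {t : ℝ} (ht : t < -1) : gJ t ^ 2 = (-1 - t)⁻¹ := by
  rw [gJ_of_lt ht, inv_pow, Real.sq_sqrt (by linarith)]

/-- The junk drift is the rest state from `−1` on. [folklore] -/
theorem drift_gJ_of_ge {t : ℝ} (ht : -1 ≤ t) : drift gJ t = 0 := by
  funext x; simp [drift, gJ_of_ge ht]

/-- Scaled local energy of the junk drift before `−1`, in closed form: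
`r⁻¹ ∫_{B_r(x₀)} ‖u(t)‖² = |B₁| r² (−1−t)⁻¹`. [folklore] -/
theorem scaledEnergy_drift_gJ_eq {t : ℝ} (ht : t < -1) (x₀ : EuclideanSpace ℝ (Fin 3)) {r : ℝ}
    (hr : 0 < r) :
    r⁻¹ * (∫ x in ball x₀ r, ‖drift gJ t x‖ ^ 2) =
      (volume (Metric.ball (0 : EuclideanSpace ℝ (Fin 3)) 1)).toReal * r ^ 2 * (-1 - t)⁻¹ := by
  simp only [norm_drift, sq_abs]
  rw [setIntegral_const, smul_eq_mul, measureReal_def, Measure.addHaar_ball volume x₀ hr.le,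
    finrank_euclideanSpace_fin, ENNReal.toReal_mul, ENNReal.toReal_ofReal (by positivity), gJ_sq ht]
  calc r⁻¹ * (r ^ 3 * (volume (Metric.ball (0 : EuclideanSpace ℝ (Fin 3)) 1)).toReal * (-1 - t)⁻¹)
        = (r⁻¹ * r) * r ^ 2 * (volume (Metric.ball (0 : EuclideanSpace ℝ (Fin 3)) 1)).toReal *
            (-1 - t)⁻¹ := by ring
    _ = (volume (Metric.ball (0 : EuclideanSpace ℝ (Fin 3)) 1)).toReal * r ^ 2 * (-1 - t)⁻¹ := by
        rw [inv_mul_cancel₀ hr.ne']; ring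

/-! ## Every hypothesis of `ScaledEnergyBound` except `0 < T` holds at `T = −1` -/

/-- With an empty classical interval (`T ≤ 0`, `Ico 0 T = ∅`) EVERY pair `(u, p)` is a classical
solution on `[0, T)`. [folklore] -/
theorem isClassicalNSSolutionOn_of_nonpos {T : ℝ} (hT : T ≤ 0) (ν : ℝ)
    (u : ℝ → EuclideanSpace ℝ (Fin 3) → EuclideanSpace ℝ (Fin 3))
    (p : ℝ → EuclideanSpace ℝ (Fin 3) → ℝ) : IsClassicalNSSolutionOn (Set.Ico 0 T) ν 0 u p := by
  have hI : Set.Ico (0:ℝ) T = ∅ := Set.Ico_eq_empty (not_lt.2 hT)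
  rw [hI]
  exact
  { smooth_velocity := by intro q hq; simp at hq
    smooth_pressure := by intro q hq; simp at hq
    momentum := fun t ht => absurd ht (Set.notMem_empty t)
    divFree := fun t ht => absurd ht (Set.notMem_empty t) }

/-- The junk drift is "Leray–Hopf on `[0, −1)`": every clause of the package lives at times
`t ≥ 0 > −1`, where the field is the rest state. [folklore] -/
theorem isLerayHopfOn_drift_gJ (ν : ℝ) : IsLerayHopfOn (-1) ν 0 (drift gJ 0) (drift gJ) := by
  have hI : Set.Ioo (0:ℝ) (-1) = ∅ := Set.Ioo_eq_empty (by norm_num)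
  have hIcc : ∀ t : ℝ, t ∉ Set.Icc (0:ℝ) (-1) := fun t ht => absurd (ht.1.trans ht.2) (by norm_num)
  have hev0 : ∀ᶠ t in 𝓝[>] (0:ℝ), drift gJ t = drift gJ 0 := by
    filter_upwards [self_mem_nhdsWithin] with t ht
    have ht' : (0:ℝ) < t := ht
    rw [drift_gJ_of_ge (show (-1:ℝ) ≤ t by linarith), drift_gJ_of_ge (show (-1:ℝ) ≤ 0 by norm_num)]
  refine
  { weak := ?_
    energy_bound := ⟨0, by rw [hI, Measure.restrict_empty]; exact ae_zero.symm ▸ eventually_bot⟩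
    memLp := fun t ht => absurd ht (hIcc t)
    weakGrad_energy := ⟨0, ?_, ?_, fun t ht => absurd ht (hIcc t), ?_⟩
    weak_continuous := fun w _ => ⟨?_, ?_⟩
    strong_initial := ?_ }
  · refine ⟨?_, ?_, ?_, ?_⟩
    · rw [hI, Set.empty_prod, Measure.restrict_empty]; exact aestronglyMeasurable_zero_measure _
    · intro K _; rw [hI, Set.empty_prod, Measure.restrict_empty, lintegral_zero_measure]
      exact ENNReal.zero_lt_top
    · rw [hI, Measure.restrict_empty]; exact ae_zero.symm ▸ eventually_bot
    · intro ψ _ _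
      rw [hI, Measure.restrict_empty, integral_zero_measure, drift_gJ_of_ge (by norm_num)]
      simp
  · rw [hI, Measure.restrict_empty]; exact ae_zero.symm ▸ eventually_bot
  · rw [hI, Measure.restrict_empty, lintegral_zero_measure]; exact ENNReal.zero_lt_top
  · rw [hI, Measure.restrict_empty]; exact ae_zero.symm ▸ eventually_bot
  · rw [Set.Ioc_eq_empty (by norm_num)]; exact continuousOn_empty _
  · refine tendsto_const_nhds.congr' ?_
    filter_upwards [hev0] with t ht
    rw [ht]
  · refine tendsto_const_nhds.congr' ?_
    filter_upwards [hev0] with t ht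
    rw [ht, sub_self]
    simp

/-- The junk drift saturates the Type-I(1) rate before `T = −1`: `√(−1−t)‖u(t,x)‖ = 1`. [folklore] -/
theorem rate_drift_gJ : ∀ᶠ t in 𝓝[<] (-1 : ℝ), ∀ x : EuclideanSpace ℝ (Fin 3),
    Real.sqrt (-1 - t) * ‖drift gJ t x‖ ≤ 1 * Real.sqrt 1 := by
  filter_upwards [self_mem_nhdsWithin] with t ht x
  have ht' : t < -1 := ht
  have hs : 0 < Real.sqrt (-1 - t) := Real.sqrt_pos.2 (by linarith)
  rw [norm_drift, abs_of_pos (gJ_pos ht'), gJ_of_lt ht', mul_inv_cancel₀ hs.ne']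
  simp

/-- `(−1−t)⁻¹ → +∞` as `t ↑ −1`. [folklore] -/
theorem tendsto_inv_neg_one_sub : Tendsto (fun t : ℝ => (-1 - t)⁻¹) (𝓝[<] (-1)) atTop := by
  have h1 : Tendsto (fun t : ℝ => -1 - t) (𝓝[<] (-1 : ℝ)) (𝓝[>] 0) := by
    refine tendsto_nhdsWithin_iff.2 ⟨?_, ?_⟩
    · have h : Tendsto (fun t : ℝ => -1 - t) (𝓝 (-1 : ℝ)) (𝓝 (-1 - -1)) :=
        tendsto_const_nhds.sub tendsto_id
      rw [sub_self] at h
      exact h.mono_left nhdsWithin_le_nhds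
    · filter_upwards [self_mem_nhdsWithin] with t ht
      exact mem_Ioi.2 (by simpa using ht)
  exact tendsto_inv_nhdsGT_zero.comp h1

/-- **`ScaledEnergyBound` (stmt-NavierStokesRegularity-2884) is false without `0 < T`.** With the
clause `0 < T` removed (everything else verbatim), take `C = 1`, `ν = 1`, `T = −1` and the junk drift:
classical on `Ico 0 (−1) = ∅`, "Leray–Hopf on `[0,−1)`", datum `0`, rate `√(−1−t)‖u‖ = 1`; but at the
radius `r = r₀` and centre `0` the scaled local energy is `|B₁| r₀² (−1−t)⁻¹ → ∞`, so no `A` bounds it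
eventually. Hence any proof of 2884 must use `0 < T` (it places the `∀ᶠ t in 𝓝[<] T` slices inside the
classical interval), and sub-statements about slices must keep their times in `[0, T)`. [folklore] -/
theorem scaledEnergyBound_false_without_posT :
    ¬ (∀ C : ℝ, 0 < C → ∃ A : ℝ, ∀ (ν T : ℝ), 0 < ν →
      ∀ (u : ℝ → EuclideanSpace ℝ (Fin 3) → EuclideanSpace ℝ (Fin 3)) (p : ℝ → EuclideanSpace ℝ (Fin 3) → ℝ),
        IsClassicalNSSolutionOn (Set.Ico 0 T) ν 0 u p → IsLerayHopfOn T ν 0 (u 0) u →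
        HasRapidSpatialDecay (u 0) →
        (∀ᶠ t in 𝓝[<] T, ∀ x, Real.sqrt (T - t) * ‖u t x‖ ≤ C * Real.sqrt ν) →
        ∃ r₀ : ℝ, 0 < r₀ ∧ ∀ᶠ t in 𝓝[<] T, ∀ x₀ : EuclideanSpace ℝ (Fin 3), ∀ r : ℝ, 0 < r → r ≤ r₀ →
          r⁻¹ * (∫ x in ball x₀ r, ‖u t x‖ ^ 2) ≤ A * ν ^ 2) := by
  intro h
  obtain ⟨A, h⟩ := h 1 one_pos
  obtain ⟨r₀, hr₀, hev⟩ := h 1 (-1) one_pos (drift gJ) (fun _ _ => 0)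
    (isClassicalNSSolutionOn_of_nonpos (by norm_num) 1 _ _) (isLerayHopfOn_drift_gJ 1)
    (drift_rapidDecay gJ_zero) rate_drift_gJ
  have hB : 0 < (volume (Metric.ball (0 : EuclideanSpace ℝ (Fin 3)) 1)).toReal :=
    ENNReal.toReal_pos (measure_ball_pos volume (0 : EuclideanSpace ℝ (Fin 3)) one_pos).ne'
      measure_ball_lt_top.ne
  have hsq : Tendsto (fun t => (volume (Metric.ball (0 : EuclideanSpace ℝ (Fin 3)) 1)).toReal *
      r₀ ^ 2 * (-1 - t)⁻¹) (𝓝[<] (-1)) atTop :=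
    tendsto_inv_neg_one_sub.const_mul_atTop (by positivity)
  obtain ⟨t, ⟨hle, hgt⟩, ht⟩ :=
    ((hev.and (hsq.eventually_gt_atTop (A * 1 ^ 2))).and self_mem_nhdsWithin).exists
  have h1 := hle 0 r₀ hr₀ le_rfl
  rw [scaledEnergy_drift_gJ_eq ht 0 hr₀] at h1
  exact absurd h1 (not_le.2 hgt)

end Summit.NavierStokesRegularity.NavierStokesRegularity.Theorems.TypeIConcentration.Negative

end
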